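import Summits.MatrixMultiplication.OmegaCensus.ThreeSetZ5Z5Cover6Defs
import HarnessLib

/-!
# Plane (`ℤ₅ × ℤ₅`) row certificates for the three-set identity with `W = {0, e₁, e₂}`: refutation and pinning

ω-census `pub-omega`, family (b3), seat pub-omega-group gen 37.  Framing: lottery ticket; floor = certified bounds/negative
ranges.  VALUE: kernel infrastructure for the `ℤ₅²`-stage of the census cells `(3,3,12)@325` and `(3,4,9)@325` of `ℤ₅ × ℤ₆₅`
(`ThreeSetZ5Z65Cells3x.lean`); NOT progress on ω.

Setting.  A three-set cube symmetric form over `A ↠ ℤ₅ × ℤ₅` with `|A| = 325` and `Φ'(W) = T = {0, e₁, e₂}` gives the PLANE identity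
(`ThreeSetCharacterIdentities.three_set_line_identity` with `B = ZMod 5 × ZMod 5`)
`Σ_u M(t,u)·G(u) + [s = t] = 13` for all `t`, `M(t,u) = Σ_{v ∈ T} (F(t−u+v) + F(v+u−t) + F(t+u−v))` (`planeMat F`), where `F`, `G` are the
fibre counts of `X`, `Y` and `s = Φ'(x₀)`.  For the finitely many image multisets `F` without a certified LINE direction
(`ThreeSetZ5Z5CoverKitE.lean`), the plane matrix is nonsingular and ONE integer row of `N·M(F)⁻¹` decides a hole position:
* `rowOK F y N u₀` — `Σ_t y(t)·M(t,u) = N·[u = u₀]` for all `u` (pure-`ℕ/ℤ` list arithmetic on point indices `5a + b`, matrix `pmNat`);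
  then pairing the identity with `y` gives `N·G(u₀) = 13·Σy − y(s)` (`mul_eq_of_rowOK`);
* **`false_of_refuteOK`** — if moreover `13·Σy − y(s) < 0` or `N ∤ 13·Σy − y(s)`, the identity is impossible;
* **`eq_of_pinOK`** — `25` rows with `13·Σy_u − y_u(s) = N_u·h(u)` PIN the unknown: `G = gridFn h`;
* `bridgeOK F` — the (per-`F`, kernel-decided) agreement of the `ZMod`-level matrix `planeMat F` with its pure-`ℕ` twin `pmNat F`.
Nothing in the certificates is trusted; everything is re-checked by `decide`.  Data and uses: `ThreeSetZ5Z5Cover33.lean`,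
`ThreeSetZ5Z5Cover34.lean`.
-/

namespace Summit.MatrixMultiplication.OmegaCensus

namespace Z5Z5ThreeSet

open Finset ZpZpDomino

/-- A list of `25` naturals read as a function on `ZMod 5 × ZMod 5` through the point numbering `ptIdx` (`5·u₁ + u₂`). [folklore] -/
def gridFn (F : List ℕ) : ZMod 5 × ZMod 5 → ℕ := fun w => F.getD (ptIdx 5 w) 0

/-- The plane matrix of the three-set identity for `W = {0, e₁, e₂}`:
`M(t,u) = Σ_{v ∈ T} (F(t−u+v) + F(v+u−t) + F(t+u−v))`. [folklore] -/
def planeMat (F : List ℕ) (t u : ZMod 5 × ZMod 5) : ℕ :=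
  (gridFn F (t - u + (0, 0)) + gridFn F ((0, 0) + u - t) + gridFn F (t + u - (0, 0))) +
  (gridFn F (t - u + (1, 0)) + gridFn F ((1, 0) + u - t) + gridFn F (t + u - (1, 0))) +
  (gridFn F (t - u + (0, 1)) + gridFn F ((0, 1) + u - t) + gridFn F (t + u - (0, 1)))

/-- Point index `5a + b`. [folklore] -/
def pI (a b : ℕ) : ℕ := 5 * a + b

/-- Pure-`ℕ` twin of `planeMat` on point indices (`ti = 5t₁ + t₂`, `ui = 5u₁ + u₂`). [folklore] -/
def pmNat (F : List ℕ) (ti ui : ℕ) : ℕ :=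
  ([(0, 0), (1, 0), (0, 1)] : List (ℕ × ℕ)).foldr (fun v acc =>
    F.getD (pI ((ti / 5 + v.1 + 5 - ui / 5) % 5) ((ti % 5 + v.2 + 5 - ui % 5) % 5)) 0 +
    F.getD (pI ((v.1 + ui / 5 + 5 - ti / 5) % 5) ((v.2 + ui % 5 + 5 - ti % 5) % 5)) 0 +
    F.getD (pI ((ti / 5 + ui / 5 + 5 - v.1) % 5) ((ti % 5 + ui % 5 + 5 - v.2) % 5)) 0 + acc) 0

/-- **Bridge check** (decided per `F`): `planeMat F` agrees with `pmNat F` on all `625` index pairs. [folklore] -/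
def bridgeOK (F : List ℕ) : Bool :=
  (List.range 25).all fun ti => (List.range 25).all fun ui => planeMat F (pt 5 ti) (pt 5 ui) == pmNat F ti ui

/-- **Row certificate check**: `Σ_t y(t)·M(t,u) = N·[u = u₀]` for every `u < 25` (integer list arithmetic). [folklore] -/
def rowOK (F : List ℕ) (y : List ℤ) (N u₀ : ℕ) : Bool :=
  (List.range 25).all fun ui =>
    ((List.range 25).map fun ti => y.getD ti 0 * (pmNat F ti ui : ℤ)).sum == (if ui = u₀ then (N : ℤ) else 0)

/-- The paired right-hand side `13·Σy − y(σ)`. [folklore] -/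
def rowRHS (y : List ℤ) (σ : ℕ) : ℤ := 13 * ((List.range 25).map fun ti => y.getD ti 0).sum - y.getD σ 0

/-- **Refutation certificate** for hole index `σ`: a row `(u₀, N, y)` with `rowOK` and `13·Σy − y(σ)` negative or not divisible
by `N`. [folklore] -/
def refuteOK (F : List ℕ) (σ : ℕ) (c : ℕ × ℕ × List ℤ) : Bool :=
  bridgeOK F && rowOK F c.2.2 c.2.1 c.1 && (decide (rowRHS c.2.2 σ < 0) || rowRHS c.2.2 σ % (c.2.1 : ℤ) != 0)

/-- One row of a pinning certificate: `rowOK`, `0 < N` and `13·Σy − y(σ) = N·h(u₀)`. [folklore] -/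
def pinRowOK (F : List ℕ) (σ : ℕ) (h : List ℕ) (rows : List (ℕ × List ℤ)) (u₀ : ℕ) : Bool :=
  rowOK F (rows.getD u₀ (0, [])).2 (rows.getD u₀ (0, [])).1 u₀ && decide (0 < (rows.getD u₀ (0, [])).1) &&
    (rowRHS (rows.getD u₀ (0, [])).2 σ == ((rows.getD u₀ (0, [])).1 : ℤ) * (h.getD u₀ 0 : ℤ))

/-- **Pinning certificate** for hole index `σ` and claimed solution `h`: the bridge check and a certified row for every `u₀ < 25`.
[folklore] -/
def pinOK (F : List ℕ) (σ : ℕ) (h : List ℕ) (rows : List (ℕ × List ℤ)) : Bool :=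
  bridgeOK F && (List.range 25).all (pinRowOK F σ h rows)

/-! ## Semantics -/

/-- A sum over `ZMod 5 × ZMod 5` as a list sum over the `25` point indices. [folklore] -/
theorem sum_eq_list_sum (f : ZMod 5 × ZMod 5 → ℤ) : ∑ t, f t = ((List.range 25).map fun i => f (pt 5 i)).sum := by
  have h1 : ∑ t, f t = ∑ i : Fin (5 * 5), f (pt 5 i.val) :=
    (Fintype.sum_equiv (ptEquiv 5) (fun i => f (pt 5 i.val)) f fun _ => rfl).symm
  rw [h1, Fin.sum_univ_eq_sum_range (fun i => f (pt 5 i)) (5 * 5), Finset.sum_eq_multiset_sum, Finset.range_val]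
  rfl

/-- Reading `bridgeOK`. [folklore] -/
theorem planeMat_eq_pmNat {F : List ℕ} (h : bridgeOK F = true) (t u : ZMod 5 × ZMod 5) :
    planeMat F t u = pmNat F (ptIdx 5 t) (ptIdx 5 u) := by
  simp only [bridgeOK, List.all_eq_true, List.mem_range, beq_iff_eq] at h
  have := h (ptIdx 5 t) (ptIdx_lt 5 t) (ptIdx 5 u) (ptIdx_lt 5 u)
  rwa [pt_ptIdx, pt_ptIdx] at this

/-- **Pairing the plane identity with a certified row**: `N·G(pt u₀) = 13·Σy − y(σ)`. [folklore] -/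
theorem mul_eq_of_rowOK {F : List ℕ} {y : List ℤ} {N u₀ : ℕ} (hb : bridgeOK F = true) (hrow : rowOK F y N u₀ = true)
    (hu₀ : u₀ < 25) (G : ZMod 5 × ZMod 5 → ℕ) {σ : ℕ} (hσ : σ < 25)
    (hid : ∀ t : ZMod 5 × ZMod 5, (∑ u : ZMod 5 × ZMod 5, planeMat F t u * G u) + (if pt 5 σ = t then 1 else 0) = 13) :
    (N : ℤ) * (G (pt 5 u₀) : ℤ) = rowRHS y σ := by
  simp only [rowOK, List.all_eq_true, List.mem_range, beq_iff_eq] at hrow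
  -- the column relation as a statement over `ZMod 5 × ZMod 5`
  have hcol : ∀ u : ZMod 5 × ZMod 5, ∑ t : ZMod 5 × ZMod 5, y.getD (ptIdx 5 t) 0 * (planeMat F t u : ℤ) =
      if u = pt 5 u₀ then (N : ℤ) else 0 := by
    intro u
    have h1 := hrow (ptIdx 5 u) (ptIdx_lt 5 u)
    rw [sum_eq_list_sum]
    have e : ((List.range 25).map fun i => y.getD (ptIdx 5 (pt 5 i)) 0 * (planeMat F (pt 5 i) u : ℤ)) =
        (List.range 25).map fun ti => y.getD ti 0 * (pmNat F ti (ptIdx 5 u) : ℤ) := by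
      refine List.map_congr_left fun i hi => ?_
      rw [List.mem_range] at hi
      rw [ptIdx_pt 5 hi, planeMat_eq_pmNat hb, ptIdx_pt 5 hi]
    rw [e, h1]
    by_cases hu : u = pt 5 u₀
    · rw [if_pos hu, if_pos (by rw [hu, ptIdx_pt 5 hu₀])]
    · rw [if_neg hu, if_neg (fun e' => hu (by rw [← e', pt_ptIdx]))]
  -- pair the identity with `y`
  have hpair : ∑ t : ZMod 5 × ZMod 5, y.getD (ptIdx 5 t) 0 *
      (((∑ u : ZMod 5 × ZMod 5, planeMat F t u * G u) + (if pt 5 σ = t then 1 else 0) : ℕ) : ℤ) =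
      ∑ t : ZMod 5 × ZMod 5, y.getD (ptIdx 5 t) 0 * (13 : ℤ) := sum_congr rfl fun t _ => by rw [hid t]; rfl
  have lhs : ∑ t : ZMod 5 × ZMod 5, y.getD (ptIdx 5 t) 0 *
      (((∑ u : ZMod 5 × ZMod 5, planeMat F t u * G u) + (if pt 5 σ = t then 1 else 0) : ℕ) : ℤ) =
      (∑ u : ZMod 5 × ZMod 5, (G u : ℤ) * ∑ t : ZMod 5 × ZMod 5, y.getD (ptIdx 5 t) 0 * (planeMat F t u : ℤ)) +
        y.getD (ptIdx 5 (pt 5 σ)) 0 := by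
    have e : ∀ t : ZMod 5 × ZMod 5, y.getD (ptIdx 5 t) 0 *
        (((∑ u : ZMod 5 × ZMod 5, planeMat F t u * G u) + (if pt 5 σ = t then 1 else 0) : ℕ) : ℤ) =
        (∑ u : ZMod 5 × ZMod 5, y.getD (ptIdx 5 t) 0 * ((planeMat F t u : ℤ) * (G u : ℤ))) +
          (if pt 5 σ = t then y.getD (ptIdx 5 t) 0 else 0) := by
      intro t
      push_cast
      rw [mul_add, mul_sum]
      congr 1
      split_ifs <;> simp
    rw [sum_congr rfl fun t _ => e t, sum_add_distrib, sum_ite_eq, if_pos (mem_univ _), sum_comm]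
    congr 1
    refine sum_congr rfl fun u _ => ?_
    rw [mul_sum]
    exact sum_congr rfl fun t _ => by ring
  rw [lhs] at hpair
  simp only [hcol, mul_ite, mul_zero, sum_ite_eq', mem_univ, if_true] at hpair
  rw [ptIdx_pt 5 hσ] at hpair
  have hrhs : ∑ t : ZMod 5 × ZMod 5, y.getD (ptIdx 5 t) 0 * (13 : ℤ) =
      13 * ((List.range 25).map fun ti => y.getD ti 0).sum := by
    have e' : ((List.range 25).map fun i => y.getD (ptIdx 5 (pt 5 i)) 0) = (List.range 25).map fun ti => y.getD ti 0 :=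
      List.map_congr_left fun i hi => by rw [List.mem_range] at hi; rw [ptIdx_pt 5 hi]
    rw [← sum_mul, mul_comm, sum_eq_list_sum (fun t => y.getD (ptIdx 5 t) 0), e']
  rw [hrhs] at hpair
  unfold rowRHS
  linear_combination hpair

/-- **Soundness of the refutation certificate**: no `G` satisfies the plane identity with hole index `σ`. [folklore] -/
theorem false_of_refuteOK {F : List ℕ} {σ : ℕ} (hσ : σ < 25) {c : ℕ × ℕ × List ℤ} (hc : refuteOK F σ c = true) (hu₀ : c.1 < 25)
    (G : ZMod 5 × ZMod 5 → ℕ)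
    (hid : ∀ t : ZMod 5 × ZMod 5, (∑ u : ZMod 5 × ZMod 5, planeMat F t u * G u) + (if pt 5 σ = t then 1 else 0) = 13) :
    False := by
  rw [refuteOK, Bool.and_eq_true, Bool.and_eq_true, Bool.or_eq_true, decide_eq_true_eq, bne_iff_ne, ne_eq] at hc
  obtain ⟨⟨hb, hrow⟩, hbad⟩ := hc
  have key := mul_eq_of_rowOK hb hrow hu₀ G hσ hid
  rcases hbad with hneg | hdiv
  · have : (0 : ℤ) ≤ (c.2.1 : ℤ) * (G (pt 5 c.1) : ℤ) := by positivity
    linarith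
  · exact hdiv (by rw [← key, Int.mul_emod_right])

/-- **Soundness of the pinning certificate**: the plane identity with hole index `σ` forces `G = gridFn h`. [folklore] -/
theorem eq_of_pinOK {F : List ℕ} {σ : ℕ} (hσ : σ < 25) {h : List ℕ} {rows : List (ℕ × List ℤ)} (hc : pinOK F σ h rows = true)
    (G : ZMod 5 × ZMod 5 → ℕ)
    (hid : ∀ t : ZMod 5 × ZMod 5, (∑ u : ZMod 5 × ZMod 5, planeMat F t u * G u) + (if pt 5 σ = t then 1 else 0) = 13)
    (u : ZMod 5 × ZMod 5) : G u = gridFn h u := by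
  rw [pinOK, Bool.and_eq_true, List.all_eq_true] at hc
  obtain ⟨hb, hall⟩ := hc
  have h1 := hall (ptIdx 5 u) (List.mem_range.2 (ptIdx_lt 5 u))
  rw [pinRowOK, Bool.and_eq_true, Bool.and_eq_true, decide_eq_true_eq, beq_iff_eq] at h1
  obtain ⟨⟨hrow, hN⟩, hval⟩ := h1
  have key := mul_eq_of_rowOK hb hrow (ptIdx_lt 5 u) G hσ hid
  rw [pt_ptIdx, hval] at key
  unfold gridFn
  have hN' : ((rows.getD (ptIdx 5 u) (0, [])).1 : ℤ) ≠ 0 := by exact_mod_cast hN.ne'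
  exact_mod_cast mul_left_cancel₀ hN' key

/-- The inner double sum of the plane identity for a `W` whose fibre counts are the indicator of `T = {0, e₁, e₂}` and an `X` whose
fibre counts are `gridFn F` is `Σ_u planeMat F t u · G u`. [folklore] -/
theorem double_sum_eq_planeMat (Wc Xc G : ZMod 5 × ZMod 5 → ℕ) (F : List ℕ)
    (hW1 : Wc (0, 0) = 1) (hW2 : Wc (1, 0) = 1) (hW3 : Wc (0, 1) = 1)
    (hW0 : ∀ v, v ≠ (0, 0) → v ≠ (1, 0) → v ≠ (0, 1) → Wc v = 0)
    (hX : ∀ v, Xc v = gridFn F v) (t : ZMod 5 × ZMod 5) :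
    (∑ u : ZMod 5 × ZMod 5, ∑ v : ZMod 5 × ZMod 5, Wc v * (Xc (t - u + v) + Xc (v + u - t) + Xc (t + u - v)) * G u) =
      ∑ u : ZMod 5 × ZMod 5, planeMat F t u * G u := by
  have h10 : ((1, 0) : ZMod 5 × ZMod 5) ≠ (0, 0) := by decide
  have h01 : ((0, 1) : ZMod 5 × ZMod 5) ≠ (0, 0) := by decide
  have h0110 : ((0, 1) : ZMod 5 × ZMod 5) ≠ (1, 0) := by decide
  have key : ∀ u : ZMod 5 × ZMod 5,
      (∑ v : ZMod 5 × ZMod 5, Wc v * (Xc (t - u + v) + Xc (v + u - t) + Xc (t + u - v))) = planeMat F t u := by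
    intro u
    have hout : ∀ v ∈ (univ : Finset (ZMod 5 × ZMod 5)), v ∉ ({(0, 0), (1, 0), (0, 1)} : Finset (ZMod 5 × ZMod 5)) →
        Wc v * (Xc (t - u + v) + Xc (v + u - t) + Xc (t + u - v)) = 0 := by
      intro v _ hv
      simp only [mem_insert, mem_singleton, not_or] at hv
      rw [hW0 v hv.1 hv.2.1 hv.2.2, zero_mul]
    rw [← sum_subset (subset_univ ({(0, 0), (1, 0), (0, 1)} : Finset (ZMod 5 × ZMod 5))) hout,
      sum_insert (by simp [h10.symm, h01.symm]), sum_insert (by simpa using h0110.symm), sum_singleton, hW1, hW2, hW3,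
      one_mul, one_mul, one_mul]
    simp only [planeMat, hX, add_assoc]
  refine sum_congr rfl fun u _ => ?_
  rw [← sum_mul, key u]

/-! ## Bridge-free variants (the bridge is checked once per `F` by the caller) -/

/-- Refutation certificate WITHOUT the bridge check (to be supplied separately, once per `F`). [folklore] -/
def refuteRowOK (F : List ℕ) (σ : ℕ) (c : ℕ × ℕ × List ℤ) : Bool :=
  rowOK F c.2.2 c.2.1 c.1 && (decide (rowRHS c.2.2 σ < 0) || rowRHS c.2.2 σ % (c.2.1 : ℤ) != 0)

/-- **Soundness of the bridge-free refutation certificate.** [folklore] -/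
theorem false_of_refuteRowOK {F : List ℕ} (hb : bridgeOK F = true) {σ : ℕ} (hσ : σ < 25) {c : ℕ × ℕ × List ℤ}
    (hc : refuteRowOK F σ c = true) (hu₀ : c.1 < 25) (G : ZMod 5 × ZMod 5 → ℕ)
    (hid : ∀ t : ZMod 5 × ZMod 5, (∑ u : ZMod 5 × ZMod 5, planeMat F t u * G u) + (if pt 5 σ = t then 1 else 0) = 13) :
    False := by
  rw [refuteRowOK, Bool.and_eq_true, Bool.or_eq_true, decide_eq_true_eq, bne_iff_ne, ne_eq] at hc
  obtain ⟨hrow, hbad⟩ := hc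
  have key := mul_eq_of_rowOK hb hrow hu₀ G hσ hid
  rcases hbad with hneg | hdiv
  · have : (0 : ℤ) ≤ (c.2.1 : ℤ) * (G (pt 5 c.1) : ℤ) := by positivity
    linarith
  · exact hdiv (by rw [← key, Int.mul_emod_right])

/-- Pinning certificate WITHOUT the bridge check: a certified row for every `u₀ < 25`. [folklore] -/
def pinRowsOK (F : List ℕ) (σ : ℕ) (h : List ℕ) (rows : List (ℕ × List ℤ)) : Bool :=
  (List.range 25).all (pinRowOK F σ h rows)

/-- **Soundness of the bridge-free pinning certificate**: the plane identity with hole index `σ` forces `G = gridFn h`. [folklore] -/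
theorem eq_of_pinRowsOK {F : List ℕ} (hb : bridgeOK F = true) {σ : ℕ} (hσ : σ < 25) {h : List ℕ} {rows : List (ℕ × List ℤ)}
    (hc : pinRowsOK F σ h rows = true) (G : ZMod 5 × ZMod 5 → ℕ)
    (hid : ∀ t : ZMod 5 × ZMod 5, (∑ u : ZMod 5 × ZMod 5, planeMat F t u * G u) + (if pt 5 σ = t then 1 else 0) = 13)
    (u : ZMod 5 × ZMod 5) : G u = gridFn h u := by
  rw [pinRowsOK, List.all_eq_true] at hc
  have h1 := hc (ptIdx 5 u) (List.mem_range.2 (ptIdx_lt 5 u))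
  rw [pinRowOK, Bool.and_eq_true, Bool.and_eq_true, decide_eq_true_eq, beq_iff_eq] at h1
  obtain ⟨⟨hrow, hN⟩, hval⟩ := h1
  have key := mul_eq_of_rowOK hb hrow (ptIdx_lt 5 u) G hσ hid
  rw [pt_ptIdx, hval] at key
  unfold gridFn
  have hN' : ((rows.getD (ptIdx 5 u) (0, [])).1 : ℤ) ≠ 0 := by exact_mod_cast hN.ne'
  exact_mod_cast mul_left_cancel₀ hN' key

/-! ## Shifted-`ℕ` encoding of integer rows (cheap to elaborate as data) -/

/-- An integer row stored as naturals with a shift: `y(t) = ys(t) − S`. [folklore] -/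
def zrow (S : ℕ) (ys : List ℕ) : List ℤ := ys.map fun a => (a : ℤ) - (S : ℤ)

/-- Rows `(N, S, ys)` of a pinning certificate in shifted-`ℕ` encoding, converted to `(N, y)`. [folklore] -/
def zrows (rows : List (ℕ × ℕ × List ℕ)) : List (ℕ × List ℤ) := rows.map fun r => (r.1, zrow r.2.1 r.2.2)

end Z5Z5ThreeSet

end Summit.MatrixMultiplication.OmegaCensus
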